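import Summits.CriticalPhenomena.PercolationContinuityZ3.Theorems.PercNearOneGluingNoHeavyLowerTailThreePointGamma
import Summits.CriticalPhenomena.PercolationContinuityZ3.Theorems.PercNearOneGluingNoHeavyLowerTailCubicThreePointApexInduction
import HarnessLib

/-!
# `NoHeavyLowerTail` (stmt-CriticalPhenomena-4575) — `Γ ≥ 0` in prim-ineq-gen-2's forced-edge vocabulary: `0 ≤ GamW E D p K a b c` for every
# random-edge set `D`, forced set `K` disjoint from `D`, support `E ⊇ D ∪ K` — the hypothesis of `CubicThreePointApex.gamma_of_lemmaB` discharged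

Support file (prover prim-cert-2 gen 9; `--supports stmt-CriticalPhenomena-4575`).  No definitions, no named facts, no sorries.

`…ThreePointGamma` proves `Γ ≥ 0` (prim-lit-2 PROOF-GAMMA; `ThreePointGamma.gamma_PrW`) for the weighted cube `PrW D p` with cells written through
`Gladkov.cl` / `DecisionTree.conn`.  prim-ineq-gen-2's apex files (`…CubicThreePointApexRefined/Induction`, HMAX-SPLIT.md) write the same row as
`GamW E D p K a b c` with FORCED edges `K` (`CubicThreePointStep.R K S`), the pivotal cell `evN` (`Rdel`) and the separating cell `evNp E` (`Sep E`), and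
reduced `0 ≤ GamW` to the open 'Lemma B' (`gamma_of_lemmaB`).  This file is the dictionary and the unconditional statement:
* `R_empty_iff`, `Rdel_empty_iff`, `Sep_empty_iff` and the seven cell identities `evQ/evT/evU₁/evU₂/evU₃/evN/evNp` at `K = ∅` ↔ `conn`, `pivEv`, `sepEv`;
* `gamW_empty_nonneg` — `0 ≤ GamW D D p ∅ a b c`; `gamW_empty_nonneg_of_subset` — `0 ≤ GamW E D p ∅ a b c` for `D ⊆ E` (`GamW_mono_support`);
* `PrW_insert_forced` — forcing one edge = adding it as a weight-one coordinate: `PrW (insert e D) (update p e 1) X = PrW D p {S | insert e S ∈ X}` (`e ∉ D`);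
* **`gamW_nonneg`** — `0 ≤ GamW E D p K a b c` for all `p ∈ [0,1]`, `Disjoint D K`, `D ∪ K ⊆ E` (induction on `K` with the section identities `sect_ev*`).
-/

noncomputable section

namespace Summit.CriticalPhenomena.PercolationContinuityZ3.Theorems

namespace ThreePointGamma

open Finset SimpleGraph Literature.Probability.Percolation Literature.Probability.Percolation.DecisionTree
open Literature.Probability.Percolation.Gladkov ThreePointLB CubicThreePointStep CubicThreePointApex
open scoped Classical

variable {V : Type*} [Fintype V] [DecidableEq V]

/-! ### The dictionary at `K = ∅` -/

omit [Fintype V] in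
/-- `R ∅ S x y ↔ S ∈ conn x y`. [this work] -/
theorem R_empty_iff (S : Finset (Sym2 V)) (x y : V) : CubicThreePointStep.R ∅ S x y ↔ S ∈ conn x y := by
  unfold CubicThreePointStep.R; rw [Finset.union_empty]; rfl

/-- The configuration with the pairs at `a` removed. [this work] -/
theorem coe_sdiff_touch_singleton (S : Finset (Sym2 V)) (a : V) :
    {f : Sym2 V | f ∈ S ∪ (∅ : Finset (Sym2 V)) ∧ a ∉ f} = (↑(S \ touch {a}) : Set (Sym2 V)) := by
  ext f
  simp only [Finset.union_empty, Set.mem_setOf_eq, Finset.coe_sdiff, Set.mem_sdiff, Finset.mem_coe, mem_touch, Finset.mem_singleton,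
    exists_eq_left]

/-- `Rdel ∅ S a b c ↔ c ∈ cl (S ∖ touch {a}) b`. [this work] -/
theorem Rdel_empty_iff (S : Finset (Sym2 V)) (a b c : V) : Rdel ∅ S a b c ↔ c ∈ cl (S \ touch {a}) b := by
  unfold Rdel; rw [coe_sdiff_touch_singleton, mem_cl]; rfl

/-- The support pairs avoiding the open cluster of `a`. [this work] -/
theorem coe_sdiff_touch_cl (E S : Finset (Sym2 V)) (a : V) :
    {f : Sym2 V | f ∈ E ∧ ∀ z, z ∈ f → ¬ CubicThreePointStep.R ∅ S a z} = (↑(E \ touch (cl S a)) : Set (Sym2 V)) := by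
  ext f
  simp only [Set.mem_setOf_eq, Finset.coe_sdiff, Set.mem_sdiff, Finset.mem_coe, mem_touch, not_exists, not_and, R_empty_iff,
    mem_conn_iff_mem_cl]
  constructor
  · rintro ⟨hf, h⟩; exact ⟨hf, fun z hz hzf => h z hzf hz⟩
  · rintro ⟨hf, h⟩; exact ⟨hf, fun z hzf hz => h z hz hzf⟩

/-- `Sep E ∅ S a b c ↔ S ∈ sepEv E a b c`. [this work] -/
theorem Sep_empty_iff (E S : Finset (Sym2 V)) (a b c : V) : CubicThreePointApex.Sep E ∅ S a b c ↔ S ∈ sepEv E a b c := by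
  unfold CubicThreePointApex.Sep; rw [coe_sdiff_touch_cl, mem_sepEv, mem_cl]; rfl

omit [Fintype V] in
/-- `a|b|c` at `K = ∅`. [this work] -/
theorem evQ_empty (a b c : V) : evQ (∅ : Finset (Sym2 V)) a b c = (conn a b)ᶜ ∩ ((conn a c)ᶜ ∩ (conn b c)ᶜ) := by
  ext S; simp only [mem_evQ, R_empty_iff, Set.mem_inter_iff, Set.mem_compl_iff]
omit [Fintype V] in
/-- `abc` at `K = ∅`. [this work] -/
theorem evT_empty (a b c : V) : evT (∅ : Finset (Sym2 V)) a b c = conn a b ∩ conn a c := by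
  ext S; simp only [mem_evT, R_empty_iff, Set.mem_inter_iff]
omit [Fintype V] in
/-- `ab|c` at `K = ∅`. [this work] -/
theorem evU₁_empty (a b c : V) : evU₁ (∅ : Finset (Sym2 V)) a b c = conn a b ∩ (conn a c)ᶜ := by
  ext S; simp only [mem_evU₁, R_empty_iff, Set.mem_inter_iff, Set.mem_compl_iff]
omit [Fintype V] in
/-- `ac|b` at `K = ∅`. [this work] -/
theorem evU₂_empty (a b c : V) : evU₂ (∅ : Finset (Sym2 V)) a b c = conn a c ∩ (conn a b)ᶜ := by
  ext S; simp only [mem_evU₂, R_empty_iff, Set.mem_inter_iff, Set.mem_compl_iff]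
omit [Fintype V] in
/-- `bc|a` at `K = ∅`. [this work] -/
theorem evU₃_empty (a b c : V) : evU₃ (∅ : Finset (Sym2 V)) a b c = conn b c ∩ (conn a b)ᶜ := by
  ext S; simp only [mem_evU₃, R_empty_iff, Set.mem_inter_iff, Set.mem_compl_iff]
/-- `abc ∧ a pivotal` at `K = ∅`. [this work] -/
theorem evN_empty (a b c : V) : evN (∅ : Finset (Sym2 V)) a b c = (conn a b ∩ conn a c) ∩ pivEv a b c := by
  ext S; simp only [mem_evN, R_empty_iff, Rdel_empty_iff, Set.mem_inter_iff, mem_pivEv, and_assoc]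
/-- `a|b|c ∧ separating` at `K = ∅`. [this work] -/
theorem evNp_empty (E : Finset (Sym2 V)) (a b c : V) :
    evNp E (∅ : Finset (Sym2 V)) a b c = ((conn a b)ᶜ ∩ ((conn a c)ᶜ ∩ (conn b c)ᶜ)) ∩ sepEv E a b c := by
  ext S; simp only [mem_evNp, R_empty_iff, Sep_empty_iff, Set.mem_inter_iff, Set.mem_compl_iff]

/-! ### `Γ ≥ 0` without forced edges -/

section Main

variable {p : Sym2 V → ℝ} (hp0 : ∀ i, 0 ≤ p i) (hp1 : ∀ i, p i ≤ 1)
include hp0 hp1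

/-- **`0 ≤ GamW D D p ∅ a b c`** (support = the random-edge set, no forced edges). [this work] -/
theorem gamW_empty_nonneg (D : Finset (Sym2 V)) (a b c : V) : 0 ≤ GamW D D p ∅ a b c := by
  rw [GamW_eq, evQ_empty, evT_empty, evU₁_empty, evU₂_empty, evU₃_empty, evN_empty, evNp_empty]
  have h := gamma_PrW hp0 hp1 D a b c
  linarith

/-- `0 ≤ GamW E D p ∅ a b c` for every support `E ⊇ D`. [this work] -/
theorem gamW_empty_nonneg_of_subset {E D : Finset (Sym2 V)} (hDE : D ⊆ E) (a b c : V) : 0 ≤ GamW E D p ∅ a b c :=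
  le_trans (gamW_empty_nonneg hp0 hp1 D a b c) (GamW_mono_support D hp0 hp1 hDE ∅ a b c)

end Main

/-! ### Forcing an edge = a weight-one coordinate -/

omit [Fintype V] in
/-- Changing the weights off `D` does not change `PrW D`. [folklore] -/
theorem PrW_congr_weights (D : Finset (Sym2 V)) {p p' : Sym2 V → ℝ} (h : ∀ i ∈ D, p' i = p i) (X : Set (Finset (Sym2 V))) :
    PrW D p' X = PrW D p X := by
  unfold PrW
  refine Finset.sum_congr rfl fun S _ => ?_
  have hw : wtW D p' S = wtW D p S := by
    unfold wtW
    exact Finset.prod_congr rfl fun i hi => by rw [h i hi]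
  simp only [Set.indicator, hw]

omit [Fintype V] in
/-- **Forcing one edge is adding it as a weight-one coordinate**: for `e ∉ D`,
`PrW (insert e D) (update p e 1) X = PrW D p {S | insert e S ∈ X}`. [this work] -/
theorem PrW_insert_forced (D : Finset (Sym2 V)) (p : Sym2 V → ℝ) {e : Sym2 V} (he : e ∉ D) (X : Set (Finset (Sym2 V))) :
    PrW (insert e D) (Function.update p e 1) X = PrW D p {S | insert e S ∈ X} := by
  rw [CubicThreePointStep.PrW_split D (Function.update p e 1) he X, Function.update_self, sub_self, zero_mul, zero_add, one_mul]
  exact PrW_congr_weights D (fun i hi => Function.update_of_ne (ne_of_mem_of_not_mem hi he) 1 p) _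

/-! ### `Γ ≥ 0` with forced edges -/

/-- **`Γ ≥ 0` in the forced-edge vocabulary**: for all weights `p ∈ [0,1]`, every random-edge set `D`, every forced set `K` disjoint from `D` and
every support `E ⊇ D ∪ K`:  `0 ≤ GamW E D p K a b c`.  This is the inequality that `CubicThreePointApex.gamma_of_lemmaB` derives from the open
'Lemma B' + the BHK step; here it is unconditional (prim-lit-2 PROOF-GAMMA via `ThreePointGamma.gamma_PrW`). [this work] -/
theorem gamW_nonneg : ∀ (K D : Finset (Sym2 V)) (p : Sym2 V → ℝ), (∀ i, 0 ≤ p i) → (∀ i, p i ≤ 1) → Disjoint D K →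
    ∀ (E : Finset (Sym2 V)), D ∪ K ⊆ E → ∀ (a b c : V), 0 ≤ GamW E D p K a b c := by
  intro K
  induction K using Finset.induction_on with
  | empty =>
    intro D p hp0 hp1 _ E hE a b c
    exact gamW_empty_nonneg_of_subset hp0 hp1 (by simpa using hE) a b c
  | @insert e K heK ih =>
    intro D p hp0 hp1 hDK E hE a b c
    have heD : e ∉ D := fun h => (Finset.disjoint_left.1 hDK h) (Finset.mem_insert_self e K)
    set p' : Sym2 V → ℝ := Function.update p e 1 with hp'
    have hp0' : ∀ i, 0 ≤ p' i := fun i => by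
      by_cases hi : i = e
      · subst hi; rw [hp', Function.update_self]; norm_num
      · rw [hp', Function.update_of_ne hi]; exact hp0 i
    have hp1' : ∀ i, p' i ≤ 1 := fun i => by
      by_cases hi : i = e
      · subst hi; rw [hp', Function.update_self]
      · rw [hp', Function.update_of_ne hi]; exact hp1 i
    have hDK' : Disjoint (insert e D) K := by
      rw [Finset.disjoint_insert_left]
      exact ⟨heK, (Finset.disjoint_insert_right.1 hDK).2⟩
    have hE' : insert e D ∪ K ⊆ E := by
      rw [Finset.insert_union, ← Finset.union_insert]; exact hE
    have key := ih (insert e D) p' hp0' hp1' hDK' E hE' a b c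
    -- every cell of the forced law is a section of the weight-one law
    have hsect : ∀ X : Set (Finset (Sym2 V)), PrW (insert e D) p' X = PrW D p {S | insert e S ∈ X} :=
      fun X => PrW_insert_forced D p heD X
    rw [GamW_eq] at key ⊢
    rw [hsect, hsect, hsect, hsect, hsect, hsect, hsect, sect_evQ, sect_evT, sect_evU₁, sect_evU₂, sect_evU₃, sect_evN, sect_evNp] at key
    exact key

end ThreePointGamma

end Summit.CriticalPhenomena.PercolationContinuityZ3.Theorems

end
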